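import Literature.MeasureTheory.Group.PadicIntHaar
import Mathlib.Algebra.MvPolynomial.Equiv
import Mathlib.Algebra.Polynomial.Roots
import Mathlib.Topology.Algebra.MvPolynomial
import Mathlib.MeasureTheory.Constructions.Pi
import Mathlib.MeasureTheory.Measure.Prod
import Mathlib.MeasureTheory.Measure.Typeclasses.NullSingletonClass
import HarnessLib

/-!
# The zero set of a nonzero polynomial is null for atomless product measures; the `p`-adic case

For a nonzero polynomial `P ∈ 𝕜[x₁, …, x_N]` over an integral domain `𝕜` carrying a σ-finite Borel
measure `volume` without atoms (points are null), the hypersurface `{x ∈ 𝕜ᴺ | P(x) = 0}` is null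
for the product measure on `𝕜ᴺ` (`volume_zeroSet_mvPolynomial_eq_zero`, finite index types
`volume_zeroSet_mvPolynomial_eq_zero_of_fintype`, almost-everywhere form
`ae_eval_mvPolynomial_ne_zero`). The case `𝕜 = ℝ` is `Literature/MeasureTheory/Lebesgue/PolynomialZeroSet.lean`
(whose proof — induction on `N` through `MvPolynomial.finSuccEquiv` and Tonelli — is followed
verbatim here); the case of interest is `𝕜 = ℤ_p` with its normalised Haar measure
(`Literature/MeasureTheory/Group/PadicIntHaar.lean`): `padicInt_volume_zeroSet_mvPolynomial_eq_zero`.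

Motivation: `p`-adic densities in arithmetic statistics are integrals over `V_{ℤ_p} = ℤ_pⁿ` of
weights that are locally constant outside the zero set of a discriminant polynomial (e.g.
Bhargava–Shankar, Ann. of Math. 181 (2015), §2.7 of the published version: local weights "locally
constant outside some closed set of measure zero"); this file supplies "measure zero".

## References

* R. Caron, T. Traynor, *The zero set of a polynomial*, WSMR Report 05-02, Univ. of Windsor (2005)
  (the real case; the argument uses only Fubini and that points are null).
* M. Bhargava, A. Shankar, Ann. of Math. (2) 181 (2015) 191–242, §2.7 (use of null discriminant
  loci in `V_{ℤ_p}`).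

## Design

Typeclass hypotheses on `𝕜`: `CommRing`, `IsDomain` (finitely many roots in one variable),
`TopologicalSpace` + `IsTopologicalRing` + `T2Space` + `SecondCountableTopology` + `BorelSpace`
(measurability of zero sets in `𝕜ᴺ`), `MeasureSpace` with `SigmaFinite volume` (Tonelli) and
`NullSingletonClass volume` (finite sets are null). Declarations live in the path namespace
`Literature.MeasureTheory.Group`.
-/

noncomputable section

open MeasureTheory MvPolynomial TopologicalSpace

namespace Literature.MeasureTheory.Group

section General

variable {𝕜 : Type*} [CommRing 𝕜] [IsDomain 𝕜] [MeasureSpace 𝕜]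
  [NullSingletonClass (volume : Measure 𝕜)]

/-- A nonzero univariate polynomial over a domain has a null (indeed finite) zero set for any measure
without atoms. [folklore] -/
theorem volume_setOf_polynomial_eval_eq_zero {P : Polynomial 𝕜} (hP : P ≠ 0) :
    volume {t : 𝕜 | P.eval t = 0} = 0 := by
  classical
  have hfin : {t : 𝕜 | P.eval t = 0}.Finite := by
    refine (P.roots.toFinset.finite_toSet).subset fun t ht ↦ ?_
    simp only [Set.mem_setOf_eq] at ht
    simp only [Finset.mem_coe, Multiset.mem_toFinset]
    exact (Polynomial.mem_roots hP).2 ht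
  exact hfin.measure_zero volume

variable [TopologicalSpace 𝕜] [IsTopologicalRing 𝕜] [T2Space 𝕜] [SecondCountableTopology 𝕜]
  [BorelSpace 𝕜] [SigmaFinite (volume : Measure 𝕜)]

/-- **The zero set of a nonzero polynomial in `N` variables is null** for the product of an atomless
σ-finite Borel measure on an integral domain (induction on `N` through `finSuccEquiv` and Tonelli,
as in the real case). [folklore] -/
theorem volume_zeroSet_mvPolynomial_eq_zero : ∀ (N : ℕ) (P : MvPolynomial (Fin N) 𝕜), P ≠ 0 →
    volume {x : Fin N → 𝕜 | eval x P = 0} = 0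
  | 0, P, hP => by
    have hempty : {x : Fin 0 → 𝕜 | eval x P = 0} = ∅ := by
      ext x
      simp only [Set.mem_setOf_eq, Set.mem_empty_iff_false, iff_false]
      intro h
      apply hP
      have hx : eval x P = P.coeff 0 := by
        conv_lhs => rw [MvPolynomial.eq_C_of_isEmpty P]
        rw [eval_C]
      rw [MvPolynomial.eq_C_of_isEmpty P, ← hx, h, C_0]
    rw [hempty, measure_empty]
  | N + 1, P, hP => by
    classical
    -- `P` as a polynomial in the first variable with coefficients in the other `N`
    set q : Polynomial (MvPolynomial (Fin N) 𝕜) := finSuccEquiv 𝕜 N P with hq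
    have hq0 : q ≠ 0 := by
      rw [hq]
      exact (EmbeddingLike.map_ne_zero_iff (f := finSuccEquiv 𝕜 N)).2 hP
    obtain ⟨k, hk⟩ : ∃ k, q.coeff k ≠ 0 := by
      by_contra h
      push Not at h
      exact hq0 (Polynomial.ext fun k ↦ by rw [h k, Polynomial.coeff_zero])
    -- induction hypothesis for the coefficient `q_k`
    have IH : volume {s : Fin N → 𝕜 | eval s (q.coeff k) = 0} = 0 :=
      volume_zeroSet_mvPolynomial_eq_zero N (q.coeff k) hk
    -- the zero set and its image in `𝕜 × 𝕜^N`
    set Z : Set (Fin (N + 1) → 𝕜) := {x | eval x P = 0} with hZ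
    have hZm : MeasurableSet Z :=
      (isClosed_eq (MvPolynomial.continuous_eval P) continuous_const).measurableSet
    set e := MeasurableEquiv.piFinSuccAbove (fun _ : Fin (N + 1) ↦ 𝕜) 0 with he
    have hmp : MeasurePreserving e volume volume :=
      volume_preserving_piFinSuccAbove (fun _ : Fin (N + 1) ↦ 𝕜) 0
    have hS : MeasurableSet (e.symm ⁻¹' Z) := hZm.preimage e.symm.measurable
    have h1 : volume Z = volume (e.symm ⁻¹' Z) := by
      rw [← hmp.measure_preimage hS.nullMeasurableSet]
      congr 1
      ext x
      simp
    rw [h1, Measure.volume_eq_prod, Measure.prod_apply_symm hS]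
    -- the `s`-indexed sections are root sets of univariate polynomials
    have hsec : ∀ s : Fin N → 𝕜, (fun t : 𝕜 ↦ (t, s)) ⁻¹' (e.symm ⁻¹' Z) =
        {t : 𝕜 | (Polynomial.map (eval s) q).eval t = 0} := by
      intro s
      ext t
      simp only [Set.mem_preimage, Set.mem_setOf_eq, hZ, he,
        MeasurableEquiv.piFinSuccAbove_symm_apply]
      change eval (Fin.insertNth 0 t s) P = 0 ↔ _
      rw [Fin.insertNth_zero', MvPolynomial.eval_eq_eval_mv_eval', ← hq]
    -- for almost every `s` the section polynomial is nonzero, hence has a null zero set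
    have hae : (fun s : Fin N → 𝕜 ↦ volume ((fun t : 𝕜 ↦ (t, s)) ⁻¹' (e.symm ⁻¹' Z))) =ᵐ[volume]
        fun _ ↦ 0 := by
      have hsub : {s : Fin N → 𝕜 | volume ((fun t : 𝕜 ↦ (t, s)) ⁻¹' (e.symm ⁻¹' Z)) ≠ 0} ⊆
          {s | eval s (q.coeff k) = 0} := by
        intro s hs
        by_contra hne
        apply hs
        rw [hsec s]
        apply volume_setOf_polynomial_eval_eq_zero
        intro hzero
        apply hne
        have := congrArg (fun P : Polynomial 𝕜 ↦ P.coeff k) hzero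
        simpa [Polynomial.coeff_map] using this
      exact measure_mono_null hsub IH
    rw [lintegral_congr_ae hae, lintegral_zero]

/-- **The zero set of a nonzero polynomial is null**, for any finite set of variables. [folklore] -/
theorem volume_zeroSet_mvPolynomial_eq_zero_of_fintype {σ : Type*} [Fintype σ]
    (P : MvPolynomial σ 𝕜) (hP : P ≠ 0) : volume {x : σ → 𝕜 | eval x P = 0} = 0 := by
  classical
  set N := Fintype.card σ
  set f : σ ≃ Fin N := Fintype.equivFin σ
  set P' : MvPolynomial (Fin N) 𝕜 := rename f P with hP'
  have hP'0 : P' ≠ 0 := by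
    rw [hP']
    exact (MvPolynomial.rename_injective f f.injective).ne hP
  have h0 := volume_zeroSet_mvPolynomial_eq_zero N P' hP'0
  have hmp : MeasurePreserving (MeasurableEquiv.piCongrLeft (fun _ : Fin N ↦ 𝕜) f) volume volume :=
    volume_measurePreserving_piCongrLeft (fun _ : Fin N ↦ 𝕜) f
  have hZm : MeasurableSet {x : Fin N → 𝕜 | eval x P' = 0} :=
    (isClosed_eq (MvPolynomial.continuous_eval P') continuous_const).measurableSet
  have hpre : (MeasurableEquiv.piCongrLeft (fun _ : Fin N ↦ 𝕜) f) ⁻¹'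
      {x : Fin N → 𝕜 | eval x P' = 0} = {x : σ → 𝕜 | eval x P = 0} := by
    ext x
    simp only [Set.mem_preimage, Set.mem_setOf_eq, hP', eval_rename]
    suffices h : (⇑(MeasurableEquiv.piCongrLeft (fun _ : Fin N ↦ 𝕜) f) x) ∘ f = x by rw [h]
    funext i
    simp [MeasurableEquiv.piCongrLeft, Equiv.piCongrLeft_apply_apply]
  rw [← hpre, hmp.measure_preimage hZm.nullMeasurableSet, h0]

/-- Almost-everywhere form: a nonzero polynomial is nonzero almost everywhere. [folklore] -/
theorem ae_eval_mvPolynomial_ne_zero {σ : Type*} [Fintype σ] (P : MvPolynomial σ 𝕜) (hP : P ≠ 0) :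
    ∀ᵐ x : σ → 𝕜 ∂volume, eval x P ≠ 0 := by
  rw [ae_iff]
  simpa using volume_zeroSet_mvPolynomial_eq_zero_of_fintype P hP

/-- For every measure absolutely continuous with respect to the product measure the zero set of a
nonzero polynomial is null. [folklore] -/
theorem measure_zeroSet_mvPolynomial_eq_zero_of_ac {σ : Type*} [Fintype σ] {μ : Measure (σ → 𝕜)}
    (hμ : μ ≪ volume) (P : MvPolynomial σ 𝕜) (hP : P ≠ 0) :
    μ {x : σ → 𝕜 | eval x P = 0} = 0 :=
  hμ (volume_zeroSet_mvPolynomial_eq_zero_of_fintype P hP)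

end General

/-! ## The `p`-adic case -/

section Padic

variable {p : ℕ} [Fact p.Prime]

/-- **In `ℤ_pⁿ` with its Haar probability measure, the zero set of a nonzero polynomial over `ℤ_p`
is null** (e.g. the discriminant locus `{Δ = 0}` in a space of forms `V_{ℤ_p} ≅ ℤ_pⁿ`).
[folklore] -/
theorem padicInt_volume_zeroSet_mvPolynomial_eq_zero {σ : Type*} [Fintype σ]
    (P : MvPolynomial σ ℤ_[p]) (hP : P ≠ 0) : volume {x : σ → ℤ_[p] | eval x P = 0} = 0 :=
  volume_zeroSet_mvPolynomial_eq_zero_of_fintype P hP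

/-- Almost every point of `ℤ_pⁿ` is a non-zero of a given nonzero polynomial. [folklore] -/
theorem padicInt_ae_eval_mvPolynomial_ne_zero {σ : Type*} [Fintype σ]
    (P : MvPolynomial σ ℤ_[p]) (hP : P ≠ 0) : ∀ᵐ x : σ → ℤ_[p] ∂volume, eval x P ≠ 0 :=
  ae_eval_mvPolynomial_ne_zero P hP

/-- Integral polynomials: if `P ∈ ℤ[x_σ]` is nonzero then its zero set in `ℤ_pⁿ` is null. [folklore] -/
theorem padicInt_volume_zeroSet_map_intCast_eq_zero {σ : Type*} [Fintype σ]
    (P : MvPolynomial σ ℤ) (hP : P ≠ 0) :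
    volume {x : σ → ℤ_[p] | eval x (MvPolynomial.map (Int.castRingHom ℤ_[p]) P) = 0} = 0 :=
  padicInt_volume_zeroSet_mvPolynomial_eq_zero _
    ((MvPolynomial.map_injective _ Int.cast_injective).ne hP)

end Padic

end Literature.MeasureTheory.Group

end
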